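import Summits.Ventures.HodgeRepro.Night3GSetWeilModelKP
import Summits.Ventures.HodgeRepro.Night3GSetForm

/-!
# The `G`-set Weil model with the CONCRETE form `Q = ∫ x ∧ y ∧ Λ`: the instance `gsetModelQ` without the hypothesis `hQ`,
and «S4-faces ⟹ S4» on the concrete model with the concrete form

Blind re-derivation cell `pub-hodge-repro`, seat `night-3` (gen 5).  Imports night-3's `Night3GSetWeilModelKP` (gen 4:
the honest instance `gsetModelKP Alg Q hmul hproj hQ` of the Weil model with projection and product) and
`Night3GSetForm` (this gen: the concrete form `Qc` and the theorem `Qc_line_line_conj_ne_zero`).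
Namespace `HodgeRepro.Night3.GSetModel`.

* `Qm hc hΦ a M := Qc hc hΦ (a M)` — the form of the corner product `B_M`, `∫ x ∧ y ∧ Λ_M` with
  `Λ_M = ∏_{i < |M|} L_i^{m−1}` built from the coefficient data `a M : Fin |M| → G → ℂ` (one non-degenerate
  `(1,1)`-form per factor; `Φ₀` the system of place representatives);
* `hQm`: the field `hQ` («for `N ≠ 0` every line pairs non-trivially with some line») holds for `Qm` — a THEOREM
  (`Qc_line_line_conj_ne_zero`, witness `τ = cσ`);
* **`gsetModelQ Alg a ha hmul hproj : WeilModelKP ℂ ℂ G (Multiset (Finset G))`** — gen 4's instance with `Q := Qm` and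
  `hQ` discharged: the remaining hypotheses are `hmul` (products of pull-backs of algebraic classes are algebraic, on
  the cross product `μ`) and `hproj` (the correspondence `pr_*((·) ∪ pr^*(y ∪ Λ))` with THIS `Λ` maps algebraic
  classes to algebraic classes — the contraction against `Qm N (·, y)` after the Künneth projection `κ`);
* **`weilSpace_le_alg_of_faces_q`**: «S4 on the concrete Weil spaces of the census faces + Lefschetz (1,1) on the pairs
  + `hmul` / `hproj` ⟹ the concrete Weil space of every zero-sum multiset of CM types is algebraic» — the form `Q` and
  its non-degeneracy are no longer hypotheses.

What is NOT modelled: `Alg` (S4 IS `weilSpace M ≤ Alg M`), the cycle map, the `ℚ`-structure (`K = L = ℂ`).  Nothing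
here closes S4 (`hface` stays the open input); no sealed file is touched; no Tier-2 item depends on this file; nothing
here says anything about the status of the Hodge conjecture for CM abelian varieties, which is NOT proved.
-/

set_option autoImplicit false

open Finset Module TensorProduct
open scoped Pointwise

namespace HodgeRepro.Night3.GSetModel

variable {G : Type*} [Group G] [Fintype G] [DecidableEq G] [LinearOrder G]

/-- **The concrete form of the model**: `Qm a M = Qc (a M)`, the form `∫ x ∧ y ∧ Λ_M` of the corner product `B_M`
with the coefficient data `a M` of its `|M|` factors. -/
noncomputable def Qm {c : G} (hc : IsComplexConj c) {Φ₀ : Finset G} (hΦ : IsCMType c Φ₀)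
    (a : ∀ M : Multiset (Finset G), Fin (Multiset.card M) → G → ℂ) (M : Multiset (Finset G)) :
    LinearMap.BilinForm ℂ (H M) :=
  Qc hc hΦ (a M)

/-- **The field `hQ` of the Weil model is a theorem for the concrete form**: for every `N` and every `σ` the line
`ℓ_σ` pairs non-trivially with `ℓ_{cσ}` (`Qc_line_line_conj_ne_zero`). -/
theorem hQm {c : G} (hc : IsComplexConj c) {Φ₀ : Finset G} (hΦ : IsCMType c Φ₀)
    (a : ∀ M : Multiset (Finset G), Fin (Multiset.card M) → G → ℂ)
    (ha : ∀ M i ρ, ρ ∈ Φ₀ → a M i ρ ≠ 0) :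
    ∀ N : Multiset (Finset G), N ≠ 0 → ∀ σ, ∃ τ,
      Qm hc hΦ a N (line (Multiset.card N) σ) (line (Multiset.card N) τ) ≠ 0 :=
  fun N _ σ => ⟨c * σ, Qc_line_line_conj_ne_zero hc hΦ (a N) (ha N) σ⟩

/-- **The `G`-set instance of the Weil model with the CONCRETE form**: gen 4's `gsetModelKP` with `Q := Qm` and `hQ`
discharged by `hQm`.  `H`, `κ`, `μ`, `ℓ`, `W`, `Q` are concrete (`hW`, `hℓ`, `hμℓ`, `hQ` theorems); `Alg` with `hmul`
(products of pull-backs of algebraic classes are algebraic, on the cross product `μ`) and `hproj` (the correspondence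
`pr_*((·) ∪ pr^*(y ∪ Λ))` maps algebraic classes to algebraic classes — the contraction against `Qm N (·, y)` after the
projection `κ`) are the hypotheses. -/
noncomputable def gsetModelQ {c : G} (hc : IsComplexConj c) {Φ₀ : Finset G} (hΦ : IsCMType c Φ₀)
    (Alg : ∀ M : Multiset (Finset G), Submodule ℂ (H M))
    (a : ∀ M : Multiset (Finset G), Fin (Multiset.card M) → G → ℂ)
    (ha : ∀ M i ρ, ρ ∈ Φ₀ → a M i ρ ≠ 0)
    (hmul : ∀ M N, (Submodule.map₂ (TensorProduct.mk ℂ (H M) (H N)) (Alg M) (Alg N)).map (μ M N) ≤ Alg (M + N))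
    (hproj : ∀ M N (y : H N), y ∈ Alg N →
      ((Alg (M + N)).map (κ M N)).map (LemmaP.contract ((Qm hc hΦ a N).flip y)) ≤ Alg M) :
    WeilModelKP ℂ ℂ G (Multiset (Finset G)) :=
  gsetModelKP Alg (Qm hc hΦ a) hmul hproj (hQm hc hΦ a ha)

/-- The form of `gsetModelQ` is `Qm`. -/
theorem gsetModelQ_Q {c : G} (hc : IsComplexConj c) {Φ₀ : Finset G} (hΦ : IsCMType c Φ₀)
    (Alg : ∀ M : Multiset (Finset G), Submodule ℂ (H M))
    (a : ∀ M : Multiset (Finset G), Fin (Multiset.card M) → G → ℂ)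
    (ha : ∀ M i ρ, ρ ∈ Φ₀ → a M i ρ ≠ 0)
    (hmul : ∀ M N, (Submodule.map₂ (TensorProduct.mk ℂ (H M) (H N)) (Alg M) (Alg N)).map (μ M N) ≤ Alg (M + N))
    (hproj : ∀ M N (y : H N), y ∈ Alg N →
      ((Alg (M + N)).map (κ M N)).map (LemmaP.contract ((Qm hc hΦ a N).flip y)) ≤ Alg M) (M : Multiset (Finset G)) :
    (gsetModelQ hc hΦ Alg a ha hmul hproj).Q M = Qm hc hΦ a M := rfl

/-- **«S4-faces ⟹ S4» on the concrete `G`-set model WITH THE CONCRETE FORM.**  `G` a finite group with a complex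
conjugation `c`, `Φ₀` a CM type (the place representatives), `a` non-degenerate coefficient data; `Alg` with `hmul`
(on the cross product `μ`) and `hproj` (the correspondence with `Λ_M = ∏_i L_i^{m−1}`) the algebraic-cycle hypotheses.
If the concrete Weil spaces of the conjugate pairs are algebraic (Lefschetz (1,1)) and those of the census faces are
algebraic (S4 on the faces — the route's open input), then the concrete Weil space `weilSpace M` is algebraic for
every zero-sum multiset `M` of CM types.  Compared with gen 4's `weilSpace_le_alg_of_faces_kp`, the form `Q` and its
non-degeneracy `hQ` are no longer hypotheses: `Q = ∫ x ∧ y ∧ Λ` is the concrete geometric formula and `hQ` is the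
kernel theorem `Qc_line_line_conj_ne_zero`. -/
theorem weilSpace_le_alg_of_faces_q {c : G} (hc : IsComplexConj c) {Φ₀ : Finset G} (hΦ : IsCMType c Φ₀)
    (Alg : ∀ M : Multiset (Finset G), Submodule ℂ (H M))
    (a : ∀ M : Multiset (Finset G), Fin (Multiset.card M) → G → ℂ)
    (ha : ∀ M i ρ, ρ ∈ Φ₀ → a M i ρ ≠ 0)
    (hmul : ∀ M N, (Submodule.map₂ (TensorProduct.mk ℂ (H M) (H N)) (Alg M) (Alg N)).map (μ M N) ≤ Alg (M + N))
    (hproj : ∀ M N (y : H N), y ∈ Alg N →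
      ((Alg (M + N)).map (κ M N)).map (LemmaP.contract ((Qm hc hΦ a N).flip y)) ≤ Alg M)
    (hpair : ∀ Φ, IsCMType c Φ → weilSpace {Φ, c • Φ} ≤ Alg {Φ, c • Φ})
    (hface : ∀ Φ p p', IsCMType c Φ → p' ∉ place c p →
      weilSpace (GSet.faceCornersMul c Φ p p') ≤ Alg (GSet.faceCornersMul c Φ p p'))
    (M : Multiset (Finset G)) (hM : GSet.IsZeroSumG c M) : weilSpace M ≤ Alg M :=
  weilSpace_le_alg_of_faces_kp hc Alg (Qm hc hΦ a) hmul hproj (hQm hc hΦ a ha) hpair hface M hM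

end HodgeRepro.Night3.GSetModel
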